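import Mathlib.MeasureTheory.Measure.Tilted
import Mathlib.Probability.ConditionalProbability
import Mathlib.Analysis.Convex.SpecificFunctions.Pow
import Mathlib.Analysis.Convex.Integral
import Mathlib.Analysis.SpecialFunctions.Pow.Continuity
import HarnessLib

/-!
# The tilted-path event bound: the mass of an event along the exponential (geometric) interpolation between two laws

Topic `Literature/Probability/Divergences`; namespace `Literature.Probability.Divergences`.  Everything here is PROVED
(Hölder ∕ Jensen bookkeeping); no definitions, no named facts.

THE POINT.  Let `P` be a probability law on `Ω`, `h : Ω → ℝ` with `e^h ∈ L¹(P)` and `h ∈ L¹(P)`, and for `t ∈ [0,1]` let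
`P_t := e^{t h} P ∕ ∫ e^{t h} dP` be the EXPONENTIALLY TILTED (geometric) path from `P₀ = P` to `P₁ = e^{h}P ∕ ∫e^{h}dP`.  For a
measurable event `A`:

* `setIntegral_exp_mul_le_rpow` — **numerator, by Jensen for the concave power `x ↦ x^t` under `P(· | A)`** (equivalently Hölder with
  exponents `1∕(1−t)`, `1∕t`):  `∫_A e^{t h} dP ≤ P(A)^{1−t} · (∫_A e^{h} dP)^t`;
* `exp_mul_integral_le_integral_exp_mul` — **normaliser, by Jensen for the convex `exp`**:  `e^{t ∫ h dP} ≤ ∫ e^{t h} dP`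
  (with `integrable_exp_mul_of_mem_Icc`: `e^{t h} ≤ 1 + e^{h}` gives integrability for `t ∈ [0,1]`);
* ★`tiltedMass_le` — **the bound**:
    `(∫_A e^{t h} dP) ∕ (∫ e^{t h} dP) ≤ P(A)^{1−t} · P₁(A)^t · exp(t · (log ∫ e^{h} dP − ∫ h dP))`,
  i.e. the tilted mass of `A` is at most the GEOMETRIC MEAN of the endpoint masses times `exp(t · J₀)`, where
  `J₀ := log E_P e^{h} − E_P h ≥ 0` is the JENSEN GAP of `h` under `P₀`.  By the symmetry `(P, h, t) ↔ (P₁, −h, 1−t)` the same bound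
  holds with `exp((1−t) · J₁)`, `J₁` the Jensen gap of `−h` under `P₁`; so `P_t(A) ≤ max(P₀(A), P₁(A)) · e^{min(t J₀, (1−t) J₁)}`
  (corollary `tiltedMass_le_max_mul_exp` records the one-sided form `≤ max(P₀(A), P₁(A)) · e^{t J₀}`);
* `tilted_real_apply_le` — the same in Mathlib's `Measure.tilted` currency: `(P.tilted (t • h)).real A ≤ …`;
* `weightedTiltedMass_le` — the un-normalised edition for a weight `w ≥ 0` on any measure space (base law `w dμ ∕ ∫ w dμ`), the shape
  met by interpolated densities `w·e^{t h}`.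

No sup-norm of `h` enters: an event which is rare under BOTH endpoint laws is rare along the whole path, at the price of one Jensen gap.
(Use: interpolated fibre laws `ŵ_t ∝ χ·ρ^t·ρ′^{1−t}·J = ŵ₀ · e^{t(log ρ − log ρ′)}` between two conditional laws; large-field tails are
printed for the endpoints only.)

[cite: Rudin1987, Thm 3.3 p. 62 (Jensen) and Thm 3.5 p. 63 (Hölder)]
-/

noncomputable section

open MeasureTheory ProbabilityTheory Set
open scoped ENNReal

namespace Literature.Probability.Divergences

variable {Ω : Type*} [MeasurableSpace Ω]

/-! ## §1 Integrability along the path -/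

/-- For `t ∈ [0,1]`: `e^{t x} ≤ 1 + e^{x}` (if `x ≥ 0` then `t x ≤ x`; if `x ≤ 0` then `t x ≤ 0`). [cite: Rudin1987, Thm 3.3 p. 62] -/
theorem exp_mul_le_one_add_exp {t : ℝ} (ht0 : 0 ≤ t) (ht1 : t ≤ 1) (x : ℝ) :
    Real.exp (t * x) ≤ 1 + Real.exp x := by
  rcases le_total 0 x with hx | hx
  · have h1 : Real.exp (t * x) ≤ Real.exp x := Real.exp_le_exp.2 (by nlinarith)
    linarith [Real.exp_pos (t * x)]
  · have h1 : Real.exp (t * x) ≤ Real.exp 0 := Real.exp_le_exp.2 (by nlinarith)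
    rw [Real.exp_zero] at h1
    linarith [Real.exp_pos x]

/-- Along the path the tilting density is integrable: `e^{h} ∈ L¹(P)`, `P` finite, `t ∈ [0,1]` ⟹ `e^{t h} ∈ L¹(P)`.
[cite: Rudin1987, Thm 3.3 p. 62] -/
theorem integrable_exp_mul_of_mem_Icc (P : Measure Ω) [IsFiniteMeasure P] {h : Ω → ℝ} (hm : AEStronglyMeasurable h P)
    (heh : Integrable (fun ω => Real.exp (h ω)) P) {t : ℝ} (ht0 : 0 ≤ t) (ht1 : t ≤ 1) :
    Integrable (fun ω => Real.exp (t * h ω)) P := by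
  have hb : Integrable (fun ω => 1 + Real.exp (h ω)) P := (integrable_const 1).add heh
  refine hb.mono' ?_ ?_
  · exact Real.continuous_exp.comp_aestronglyMeasurable (hm.const_mul t)
  · refine Filter.Eventually.of_forall fun ω => ?_
    rw [Real.norm_of_nonneg (Real.exp_pos _).le]
    exact exp_mul_le_one_add_exp ht0 ht1 (h ω)

/-! ## §2 The numerator: Jensen for the concave power under the conditional law -/

/-- **Numerator bound** — for a probability law `P`, `e^{h} ∈ L¹(P)`, a measurable event `A` and `t ∈ [0,1]`:
`∫_A e^{t h} dP ≤ P(A)^{1−t} · (∫_A e^{h} dP)^t` (Jensen for the concave `x ↦ x^t` under `P(·|A)`; = Hölder with exponents `1∕(1−t)`, `1∕t`).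
[cite: Rudin1987, Thm 3.5 p. 63] -/
theorem setIntegral_exp_mul_le_rpow (P : Measure Ω) [IsProbabilityMeasure P] {h : Ω → ℝ} (hm : AEStronglyMeasurable h P)
    (heh : Integrable (fun ω => Real.exp (h ω)) P) {A : Set Ω} (hA : MeasurableSet A) {t : ℝ} (ht0 : 0 ≤ t) (ht1 : t ≤ 1) :
    ∫ ω in A, Real.exp (t * h ω) ∂P ≤ (P.real A) ^ (1 - t) * (∫ ω in A, Real.exp (h ω) ∂P) ^ t := by
  by_cases hPA : P A = 0
  · -- null event: both sides vanish (or the right side is `≥ 0`)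
    have h0 : ∫ ω in A, Real.exp (t * h ω) ∂P = 0 := by
      rw [Measure.restrict_eq_zero.2 hPA, integral_zero_measure]
    rw [h0]
    exact mul_nonneg (Real.rpow_nonneg measureReal_nonneg _) (Real.rpow_nonneg (setIntegral_nonneg hA fun ω _ => (Real.exp_pos _).le) _)
  · -- `Q := P(·|A)` is a probability law; Jensen for the concave power
    haveI : IsProbabilityMeasure (P[|A]) := cond_isProbabilityMeasure hPA
    have hPApos : 0 < P.real A := by
      rw [measureReal_def]; exact ENNReal.toReal_pos hPA (measure_ne_top P A)
    have hcond : ∀ f : Ω → ℝ, ∫ ω, f ω ∂(P[|A]) = (P.real A)⁻¹ * ∫ ω in A, f ω ∂P := by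
      intro f
      rw [ProbabilityTheory.cond, integral_smul_measure, ENNReal.toReal_inv, smul_eq_mul, measureReal_def]
    -- integrability under `Q`
    have hiQ1 : Integrable (fun ω => Real.exp (h ω)) (P[|A]) := by
      rw [ProbabilityTheory.cond]; exact (heh.restrict).smul_measure (ENNReal.inv_ne_top.2 hPA)
    have hiPt : Integrable (fun ω => Real.exp (t * h ω)) P := integrable_exp_mul_of_mem_Icc P hm heh ht0 ht1
    have hiQt : Integrable ((fun x : ℝ => x ^ t) ∘ fun ω => Real.exp (h ω)) (P[|A]) := by
      have he : ((fun x : ℝ => x ^ t) ∘ fun ω => Real.exp (h ω)) = fun ω => Real.exp (t * h ω) := by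
        funext ω; simp only [Function.comp, Real.exp_mul, mul_comm t]
      rw [he, ProbabilityTheory.cond]; exact (hiPt.restrict).smul_measure (ENNReal.inv_ne_top.2 hPA)
    have hJ := (Real.concaveOn_rpow ht0 ht1).le_map_integral (Real.continuous_rpow_const ht0).continuousOn isClosed_Ici
      (Filter.Eventually.of_forall fun ω => (Real.exp_pos (h ω)).le) hiQ1 hiQt
    -- unfold the conditional law
    have hlhs : ∫ ω, (fun x : ℝ => x ^ t) (Real.exp (h ω)) ∂(P[|A]) = (P.real A)⁻¹ * ∫ ω in A, Real.exp (t * h ω) ∂P := by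
      rw [← hcond]
      refine integral_congr_ae (Filter.Eventually.of_forall fun ω => ?_)
      simp only [Real.exp_mul, mul_comm t]
    rw [hlhs, hcond] at hJ
    -- `(P A)⁻¹ ∫_A e^{th} ≤ ((P A)⁻¹ ∫_A e^h)^t` ⟹ the claim
    have hI0 : 0 ≤ ∫ ω in A, Real.exp (h ω) ∂P := setIntegral_nonneg hA fun ω _ => (Real.exp_pos _).le
    rw [Real.mul_rpow (inv_nonneg.2 hPApos.le) hI0, Real.inv_rpow hPApos.le] at hJ
    have h2 := mul_le_mul_of_nonneg_left hJ hPApos.le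
    rw [← mul_assoc, mul_inv_cancel₀ hPApos.ne', one_mul, ← mul_assoc] at h2
    have h3 : P.real A * ((P.real A) ^ t)⁻¹ = (P.real A) ^ (1 - t) := by
      rw [Real.rpow_sub hPApos, Real.rpow_one, div_eq_mul_inv]
    rwa [h3] at h2

/-! ## §3 The normaliser: Jensen for `exp` -/

/-- **Normaliser bound** — `P` a probability law, `h ∈ L¹(P)`, `e^{h} ∈ L¹(P)`, `t ∈ [0,1]`: `exp(t · ∫ h dP) ≤ ∫ e^{t h} dP`.
[cite: Rudin1987, Thm 3.3 p. 62] -/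
theorem exp_mul_integral_le_integral_exp_mul (P : Measure Ω) [IsProbabilityMeasure P] {h : Ω → ℝ} (hh : Integrable h P)
    (heh : Integrable (fun ω => Real.exp (h ω)) P) {t : ℝ} (ht0 : 0 ≤ t) (ht1 : t ≤ 1) :
    Real.exp (t * ∫ ω, h ω ∂P) ≤ ∫ ω, Real.exp (t * h ω) ∂P := by
  have hiPt : Integrable (fun ω => Real.exp (t * h ω)) P := integrable_exp_mul_of_mem_Icc P hh.aestronglyMeasurable heh ht0 ht1
  have hJ := (convexOn_exp).map_integral_le Real.continuous_exp.continuousOn isClosed_univ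
    (Filter.Eventually.of_forall fun ω => mem_univ _) (hh.const_mul t) (by exact hiPt)
  rw [integral_const_mul] at hJ
  simpa [Function.comp] using hJ

/-! ## §4 The bound -/

/-- ★ **THE TILTED-PATH EVENT BOUND** — `P` a probability law, `h ∈ L¹(P)`, `e^{h} ∈ L¹(P)`, `A` measurable, `t ∈ [0,1]`:
`(∫_A e^{t h} dP) ∕ (∫ e^{t h} dP) ≤ P(A)^{1−t} · ((∫_A e^{h} dP) ∕ ∫ e^{h} dP)^t · exp(t · (log ∫ e^{h} dP − ∫ h dP))` —
the mass of `A` under the tilted law `P_t` is at most the geometric mean of its masses under `P₀ = P` and `P₁ = e^{h}P∕∫e^{h}dP` times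
`exp(t · Jensen gap of h under P)`. [cite: Rudin1987, Thm 3.3 p. 62 and Thm 3.5 p. 63] -/
theorem tiltedMass_le (P : Measure Ω) [IsProbabilityMeasure P] {h : Ω → ℝ} (hh : Integrable h P)
    (heh : Integrable (fun ω => Real.exp (h ω)) P) {A : Set Ω} (hA : MeasurableSet A) {t : ℝ} (ht0 : 0 ≤ t) (ht1 : t ≤ 1) :
    (∫ ω in A, Real.exp (t * h ω) ∂P) / (∫ ω, Real.exp (t * h ω) ∂P)
      ≤ (P.real A) ^ (1 - t) * ((∫ ω in A, Real.exp (h ω) ∂P) / ∫ ω, Real.exp (h ω) ∂P) ^ t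
          * Real.exp (t * (Real.log (∫ ω, Real.exp (h ω) ∂P) - ∫ ω, h ω ∂P)) := by
  set Z₁ : ℝ := ∫ ω, Real.exp (h ω) ∂P with hZ₁
  set Zt : ℝ := ∫ ω, Real.exp (t * h ω) ∂P with hZt
  set N₁ : ℝ := ∫ ω in A, Real.exp (h ω) ∂P with hN₁
  have hZ₁pos : 0 < Z₁ := integral_exp_pos heh
  have hiPt : Integrable (fun ω => Real.exp (t * h ω)) P := integrable_exp_mul_of_mem_Icc P hh.aestronglyMeasurable heh ht0 ht1
  have hZtpos : 0 < Zt := integral_exp_pos hiPt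
  have hN₁0 : 0 ≤ N₁ := setIntegral_nonneg hA fun ω _ => (Real.exp_pos _).le
  have hPA0 : 0 ≤ P.real A := measureReal_nonneg
  -- numerator and normaliser
  have hnum := setIntegral_exp_mul_le_rpow P hh.aestronglyMeasurable heh hA ht0 ht1
  have hden := exp_mul_integral_le_integral_exp_mul P hh heh ht0 ht1
  -- `N_t / Z_t ≤ P(A)^{1-t} N₁^t / exp(t ∫h)`
  have hstep : (∫ ω in A, Real.exp (t * h ω) ∂P) / Zt ≤ (P.real A) ^ (1 - t) * N₁ ^ t / Real.exp (t * ∫ ω, h ω ∂P) := by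
    rw [div_le_div_iff₀ hZtpos (Real.exp_pos _)]
    calc (∫ ω in A, Real.exp (t * h ω) ∂P) * Real.exp (t * ∫ ω, h ω ∂P)
        ≤ ((P.real A) ^ (1 - t) * N₁ ^ t) * Real.exp (t * ∫ ω, h ω ∂P) :=
          mul_le_mul_of_nonneg_right hnum (Real.exp_pos _).le
      _ ≤ ((P.real A) ^ (1 - t) * N₁ ^ t) * Zt :=
          mul_le_mul_of_nonneg_left hden (mul_nonneg (Real.rpow_nonneg hPA0 _) (Real.rpow_nonneg hN₁0 _))
  -- rewrite the right member: `N₁^t e^{-t∫h} = (N₁/Z₁)^t · exp(t (log Z₁ − ∫h))`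
  have hrhs : (P.real A) ^ (1 - t) * N₁ ^ t / Real.exp (t * ∫ ω, h ω ∂P)
      = (P.real A) ^ (1 - t) * (N₁ / Z₁) ^ t * Real.exp (t * (Real.log Z₁ - ∫ ω, h ω ∂P)) := by
    have he : Real.exp (t * (Real.log Z₁ - ∫ ω, h ω ∂P)) = Z₁ ^ t / Real.exp (t * ∫ ω, h ω ∂P) := by
      rw [mul_sub, Real.exp_sub, mul_comm t (Real.log Z₁), ← Real.rpow_def_of_pos hZ₁pos]
    have hZ₁t : Z₁ ^ t ≠ 0 := (Real.rpow_pos_of_pos hZ₁pos t).ne'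
    rw [Real.div_rpow hN₁0 hZ₁pos.le, he]
    field_simp
  rw [hrhs] at hstep
  exact hstep

/-- **One-sided corollary** — under the same hypotheses, `P_t(A) ≤ max(P₀(A), P₁(A)) · exp(t · (log ∫ e^{h} dP − ∫ h dP))`
(geometric mean ≤ max).  The symmetric form with `(P₁, −h, 1−t)` gives the factor `exp((1−t)·J₁)` instead. [cite: Rudin1987, Thm 3.5 p. 63] -/
theorem tiltedMass_le_max_mul_exp (P : Measure Ω) [IsProbabilityMeasure P] {h : Ω → ℝ} (hh : Integrable h P)
    (heh : Integrable (fun ω => Real.exp (h ω)) P) {A : Set Ω} (hA : MeasurableSet A) {t : ℝ} (ht0 : 0 ≤ t) (ht1 : t ≤ 1) :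
    (∫ ω in A, Real.exp (t * h ω) ∂P) / (∫ ω, Real.exp (t * h ω) ∂P)
      ≤ max (P.real A) ((∫ ω in A, Real.exp (h ω) ∂P) / ∫ ω, Real.exp (h ω) ∂P)
          * Real.exp (t * (Real.log (∫ ω, Real.exp (h ω) ∂P) - ∫ ω, h ω ∂P)) := by
  have h1 := tiltedMass_le P hh heh hA ht0 ht1
  set a : ℝ := P.real A
  set b : ℝ := (∫ ω in A, Real.exp (h ω) ∂P) / ∫ ω, Real.exp (h ω) ∂P
  have ha : 0 ≤ a := measureReal_nonneg
  have hb : 0 ≤ b := div_nonneg (setIntegral_nonneg hA fun ω _ => (Real.exp_pos _).le) (integral_exp_pos heh).le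
  have hm0 : 0 ≤ max a b := le_max_of_le_left ha
  have hgm : a ^ (1 - t) * b ^ t ≤ max a b := by
    calc a ^ (1 - t) * b ^ t ≤ (max a b) ^ (1 - t) * (max a b) ^ t :=
          mul_le_mul (Real.rpow_le_rpow ha (le_max_left _ _) (by linarith)) (Real.rpow_le_rpow hb (le_max_right _ _) ht0)
            (Real.rpow_nonneg hb _) (Real.rpow_nonneg hm0 _)
      _ = max a b := by
          rw [← Real.rpow_add' hm0 (by norm_num : (1 - t) + t ≠ 0)]; norm_num
  exact h1.trans (mul_le_mul_of_nonneg_right hgm (Real.exp_pos _).le)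

/-! ## §5 In `Measure.tilted` currency -/

/-- The tilted-path event bound for Mathlib's exponentially tilted measure `P.tilted (t • h)`:
`(P.tilted (fun ω => t * h ω)).real A ≤ P(A)^{1−t} · ((∫_A e^{h} dP) ∕ ∫ e^{h} dP)^t · exp(t · (log ∫ e^{h} dP − ∫ h dP))`.
[cite: Rudin1987, Thm 3.3 p. 62 and Thm 3.5 p. 63] -/
theorem tilted_real_apply_le (P : Measure Ω) [IsProbabilityMeasure P] {h : Ω → ℝ} (hh : Integrable h P)
    (heh : Integrable (fun ω => Real.exp (h ω)) P) {A : Set Ω} (hA : MeasurableSet A) {t : ℝ} (ht0 : 0 ≤ t) (ht1 : t ≤ 1) :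
    (P.tilted (fun ω => t * h ω)).real A
      ≤ (P.real A) ^ (1 - t) * ((∫ ω in A, Real.exp (h ω) ∂P) / ∫ ω, Real.exp (h ω) ∂P) ^ t
          * Real.exp (t * (Real.log (∫ ω, Real.exp (h ω) ∂P) - ∫ ω, h ω ∂P)) := by
  have hiPt : Integrable (fun ω => Real.exp (t * h ω)) P := integrable_exp_mul_of_mem_Icc P hh.aestronglyMeasurable heh ht0 ht1
  have hq : (P.tilted (fun ω => t * h ω)).real A = (∫ ω in A, Real.exp (t * h ω) ∂P) / (∫ ω, Real.exp (t * h ω) ∂P) := by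
    rw [measureReal_def, tilted_apply_eq_ofReal_integral' _ hA, integral_div, ENNReal.toReal_ofReal]
    exact div_nonneg (setIntegral_nonneg hA fun ω _ => (Real.exp_pos _).le) (integral_exp_pos hiPt).le
  rw [hq]
  exact tiltedMass_le P hh heh hA ht0 ht1

/-! ## §6 Weighted edition (un-normalised base weight `w dμ`) -/

/-- **Weighted edition** — `μ` any measure, `w ≥ 0` a measurable weight with `w`, `w·h`, `w·e^{h}` `μ`-integrable and `∫ w dμ > 0`; along the
path `w·e^{t h} dμ` (`t ∈ [0,1]`), for a measurable event `A`:
`(∫_A w e^{t h}) ∕ (∫ w e^{t h}) ≤ ((∫_A w) ∕ ∫ w)^{1−t} · ((∫_A w e^{h}) ∕ ∫ w e^{h})^t · exp(t · (log((∫ w e^{h}) ∕ ∫ w) − (∫ w h) ∕ ∫ w))`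
(= `tiltedMass_le` for the probability law `w dμ ∕ ∫ w dμ`).  This is the shape met by interpolated fibre weights `χ·ρ^t·ρ′^{1−t}·J = (χ·ρ′·J)·e^{t(log ρ − log ρ′)}`.
[cite: Rudin1987, Thm 3.3 p. 62 and Thm 3.5 p. 63] -/
theorem weightedTiltedMass_le (μ : Measure Ω) {w : Ω → NNReal} (hw : Measurable w) {h : Ω → ℝ}
    (hwi : Integrable (fun ω => (w ω : ℝ)) μ) (hwh : Integrable (fun ω => (w ω : ℝ) * h ω) μ)
    (hweh : Integrable (fun ω => (w ω : ℝ) * Real.exp (h ω)) μ) (hpos : 0 < ∫ ω, (w ω : ℝ) ∂μ)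
    {A : Set Ω} (hA : MeasurableSet A) {t : ℝ} (ht0 : 0 ≤ t) (ht1 : t ≤ 1) :
    (∫ ω in A, (w ω : ℝ) * Real.exp (t * h ω) ∂μ) / (∫ ω, (w ω : ℝ) * Real.exp (t * h ω) ∂μ)
      ≤ ((∫ ω in A, (w ω : ℝ) ∂μ) / ∫ ω, (w ω : ℝ) ∂μ) ^ (1 - t)
        * ((∫ ω in A, (w ω : ℝ) * Real.exp (h ω) ∂μ) / ∫ ω, (w ω : ℝ) * Real.exp (h ω) ∂μ) ^ t
        * Real.exp (t * (Real.log ((∫ ω, (w ω : ℝ) * Real.exp (h ω) ∂μ) / ∫ ω, (w ω : ℝ) ∂μ)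
            - (∫ ω, (w ω : ℝ) * h ω ∂μ) / ∫ ω, (w ω : ℝ) ∂μ)) := by
  set c : ℝ := ∫ ω, (w ω : ℝ) ∂μ with hc
  have hc0 : c ≠ 0 := hpos.ne'
  have hci : c⁻¹ ≠ 0 := inv_ne_zero hc0
  have hcE : ENNReal.ofReal c ≠ 0 := fun h0 => (not_le.2 hpos) (ENNReal.ofReal_eq_zero.1 h0)
  set ν : Measure Ω := μ.withDensity (fun ω => (w ω : ℝ≥0∞)) with hν
  have hνuniv : ν univ = ENNReal.ofReal c := by
    rw [hν, withDensity_apply _ MeasurableSet.univ, Measure.restrict_univ, hc,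
      ofReal_integral_eq_lintegral_ofReal hwi (Filter.Eventually.of_forall fun ω => (w ω).coe_nonneg)]
    refine lintegral_congr_ae (Filter.Eventually.of_forall fun ω => ?_)
    simp only [ENNReal.ofReal_coe_nnreal]
  set P : Measure Ω := (ENNReal.ofReal c)⁻¹ • ν with hP
  haveI : IsProbabilityMeasure P :=
    ⟨by rw [hP, Measure.smul_apply, hνuniv, smul_eq_mul, ENNReal.inv_mul_cancel hcE ENNReal.ofReal_ne_top]⟩
  -- dictionary `P ↔ w dμ`
  have hint : ∀ g : Ω → ℝ, ∫ ω, g ω ∂P = c⁻¹ * ∫ ω, (w ω : ℝ) * g ω ∂μ := by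
    intro g
    rw [hP, integral_smul_measure, hν, integral_withDensity_eq_integral_smul hw, ENNReal.toReal_inv,
      ENNReal.toReal_ofReal hpos.le, smul_eq_mul]
    rfl
  have hsint : ∀ g : Ω → ℝ, ∫ ω in A, g ω ∂P = c⁻¹ * ∫ ω in A, (w ω : ℝ) * g ω ∂μ := by
    intro g
    rw [hP, Measure.restrict_smul, integral_smul_measure, hν, setIntegral_withDensity_eq_setIntegral_smul hw _ hA,
      ENNReal.toReal_inv, ENNReal.toReal_ofReal hpos.le, smul_eq_mul]
    rfl
  have hPA : P.real A = c⁻¹ * ∫ ω in A, (w ω : ℝ) ∂μ := by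
    have h1 := hsint fun _ => (1 : ℝ)
    simp only [mul_one, integral_const, smul_eq_mul] at h1
    rw [measureReal_def]
    rw [measureReal_restrict_apply_univ] at h1
    exact h1
  -- integrability under `P`
  have hIh : Integrable h P := by
    rw [hP]; refine Integrable.smul_measure ?_ (ENNReal.inv_ne_top.2 hcE)
    rw [hν, integrable_withDensity_iff_integrable_coe_smul hw]
    simpa only [smul_eq_mul] using hwh
  have hIeh : Integrable (fun ω => Real.exp (h ω)) P := by
    rw [hP]; refine Integrable.smul_measure ?_ (ENNReal.inv_ne_top.2 hcE)
    rw [hν, integrable_withDensity_iff_integrable_coe_smul hw]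
    simpa only [smul_eq_mul] using hweh
  -- the probability-law bound, translated
  have hmain := tiltedMass_le P hIh hIeh hA ht0 ht1
  rw [hsint, hint, hsint, hint, hint, hPA, mul_div_mul_left _ _ hci, mul_div_mul_left _ _ hci,
    inv_mul_eq_div, inv_mul_eq_div, inv_mul_eq_div] at hmain
  exact hmain

end Literature.Probability.Divergences

end
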